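import Summits.Ventures.CertifiedManyBodySolver.Rows.ChainMarginalNodes
import Literature.MathematicalPhysics.QuantumLattice.HubbardAndersonClusterBound
import Summits.Ventures.CertifiedManyBodySolver.Transport.TiltedAndersonClusterChain
import HarnessLib

/-!
# The GLUING-DOMINATES-ANDERSON edge, PROVED over the tree's node predicates
# (sr-mbsolver op-07 gen-10, input for hubbard-alg BET-L2; for the LIT lanes to file)

HONEST FRAMING: first certified bounds; not a superconductivity verdict; every number certified or labelled float.

An Anderson certificate `h(w,v) - q·1 ⪰ 0` on an open chain cluster `[0, ℓ)`, `ℓ ≤ k = n + 3`, with ANY admissible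
weighting (`Σ w = 1`, `Σ v = 1`) is a feasible dual point of the lane-B local-translation-invariance node on the
`k`-site window `{-1, …, n+1}` (`LTIChainNode U n ν lo`, `Rows/ChainMarginalNodes.lean`): place the cluster on the window
sites `x_0, …, x_{ℓ-1}` (`x_j = j - 1`); for every window variable `ρ` satisfying the node's rows, the LTI row makes every
bond and every site expectation inside the window equal (`Transport.trace_tlmBond_eq_of_lti`, `Transport.trace_nAt_eq_of_lti`,
`Transport.trace_toSpin_translate_eq_of_lti`), so `Re tr(toSpin Γ(h(w,v)) ρ) = -K + U·D + (U/2)(1 - 2ν)` is independent of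
`(w, v)` and equals `Re tr(toSpin Γ(incl) E_Φ ρ) + (U/2)(1 - 2ν)`; and `ρ ⪰ 0`, `toSpin Γ(h(w,v)) - q ⪰ 0` give `≥ q`.
Hence value(node) ≥ sup over `ℓ ≤ k`, `w`, `v` of the Anderson floors, BY NAME, for ALL FOUR chain node predicates of
`Rows/ChainMarginalNodes.lean` (`LTIChainNode`, `LTIChainKSDNNode` = FORMAT-ltisdp, `EntChainNode`, `EntTLMChainNode` = op-08's
`tl_marginal` form), at every filling (Anderson's `(U/2)[n ≠ 1]` convention shifts the floor by `(U/2)(1 - n)`, `n` = filling).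
Structure: ONE raw inequality `re_firstBond_ge_of_andersonChain` (rows used: `ρ ⪰ 0`, `tr ρ = 1`, the LTI row — nothing else),
two LTI identities (`trace_meanEnergy_eq_firstBond_of_lti`, `trace_nAt_zero_eq_neg_of_lti`), then one short corollary per node.
No `sorry`, no new axiom (`#print axioms` = propext, Classical.choice, Quot.sound). §6 instantiates the edge on two lane-A rows
OF RECORD (#232 `ℓ = 10`, #297 `ℓ = 15`, `U = 8`; hypotheses = their OPEN claim nodes of `Bounds/AndersonRowsChain10|15.lean`, exactly
as the rows' own TL theorems): the claim node of a row is a feasible slot of every chain window node with at least `ℓ` sites.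
[cite: Anderson1951, eq. (2)] [cite: KullEtAl2024, §II.B eq. (locTIn), §VI.B]

FILING NOTE (sr-mbsolver-lit-4 g9, 2026-08-22): this module and its sibling `Rows/AndersonDominatedByLTINodes.lean` are
sr-mbsolver-op-07 gen-10's PROVED file `HOME/sr-mbsolver-op-07/lean/AndersonDominatedByLTIProof.lean` (v3, sha256 49ccd6f8a3227803…,
612 lines, 32 theorems + 2 defs, sorry-free; op-07 HOME/INBOX l.4846 / l.4860 / l.4865 'ONE file to land or decline', one-writer rule)
split at its `### The edges into the four chain nodes` heading to respect the gate's 400-line module limit, with the working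
namespace `…CertifiedManyBodySolver.Sketch` renamed `Summit.Ventures.CertifiedManyBodySolver.Rows.AndersonDominatedByLTI`; declarations, statements and
proofs are otherwise VERBATIM except that op-07's two primed weight-sum copies are replaced by the landed Transport lemmas (gate dedup).
THIS module: the local `sum_ofLex_eq'`, the cluster placement `boxIdx` / `boxToWindow`,
the two LTI identities and the raw edge `re_firstBond_ge_of_andersonChain`. The SIBLING: the edges into the four chain node
predicates, the half-filled real-`U` forms, the M1 cells and the §6 worked instances on rows #232 / #297.
-/

noncomputable section

open Matrix Complex Finset
open scoped ComplexOrder MatrixOrder BigOperators Matrix.Norms.L2Operator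
open Literature.Probability.LatticeModels
open Literature.MathematicalPhysics.QuantumLattice
open Literature.MathematicalPhysics.QuantumLattice.AndersonCluster
open Literature.MathematicalPhysics.QuantumLattice.HubbardWave0
open Literature.MathematicalPhysics.QuantumLattice.ThermodynamicLimit
open Literature.MathematicalPhysics.QuantumLattice.JordanWigner
open Summit.Ventures.CertifiedManyBodySolver.Transport

namespace Summit.Ventures.CertifiedManyBodySolver.Rows.AndersonDominatedByLTI


/-! ### Local copy of one private coordinate lemma of `HubbardAndersonClusterBound` §7
(the two chain weight-sum lemmas are the LANDED `Transport.siteWeightSum_halfOpenBox_one` /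
`Transport.bondWeightSum_halfOpenBox_one_chainBondWeights` of `Transport/TiltedAndersonClusterChain.lean`, reused by name) -/

/-- Sums over the ordered site set `PolySite Λ'` are sums over the region `Λ'`. [folklore] -/
theorem sum_ofLex_eq' {d : ℕ} {M : Type*} [AddCommMonoid M] (Λ' : Finset (Site d)) (f : Site d → M) :
    ∑ y : PolySite Λ', f (ofLex y.1) = ∑ x ∈ Λ', f x := by
  conv_rhs => rw [← map_univ_polySiteEmb Λ', Finset.sum_map]
  rfl

/-! ### Placement of the cluster `[0, ℓ)` on the window sites `x_0, …, x_{ℓ-1}` (`x_j = j - 1`) -/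

/-- The integer index `j = x 0 ≥ 0` of a box site. [folklore] -/
def boxIdx {ℓ : ℕ} (y : PolySite (halfOpenBox 1 ℓ)) : ℕ := (ofLex y.1 0).toNat

/-- The site index of a box point: `0 ≤ boxIdx y < ℓ` and `ofLex y = boxIdx y` as an integer point. [folklore] -/
theorem boxIdx_spec {ℓ : ℕ} (y : PolySite (halfOpenBox 1 ℓ)) :
    ((boxIdx y : ℕ) : ℤ) = ofLex y.1 0 ∧ boxIdx y < ℓ := by
  have h := (mem_halfOpenBox.1 (PolySite.ofLex_mem y)) 0
  unfold boxIdx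
  omega

/-- `x + e₀ ∈ [0, ℓ)` iff `j + 1 < ℓ`. [folklore] -/
theorem succ_mem_box_iff {ℓ : ℕ} (y : PolySite (halfOpenBox 1 ℓ)) :
    ofLex y.1 + unitVec 0 ∈ halfOpenBox 1 ℓ ↔ boxIdx y + 1 < ℓ := by
  have h := boxIdx_spec y
  rw [mem_halfOpenBox, Fin.forall_fin_one]
  simp only [Pi.add_apply, unitVec, Pi.single_eq_same]
  omega

/-- **The placement** `[0, ℓ) → {-1, …, n+1}`, `x ↦ x - 1` (`ℓ ≤ n + 3`), as an injection of ordered site sets.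
[folklore] -/
def boxToWindow (n : ℕ) {ℓ : ℕ} (hℓ : ℓ ≤ n + 3) :
    PolySite (halfOpenBox 1 ℓ) ↪ PolySite (chainWindow (-1) ((n : ℤ) + 1)) :=
  ⟨fun y => PolySite.pt (tlmSite (boxIdx y)) (tlmSite_mem (by have := (boxIdx_spec y).2; omega)),
    fun y y' h => by
      apply polySite_eq_of_coord_eq
      have h1 := congrArg (fun z : PolySite (chainWindow (-1) ((n : ℤ) + 1)) => ofLex z.1 0) h
      simp only [PolySite.ofLex_coe_pt, tlmSite] at h1
      have hy := (boxIdx_spec y).1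
      have hy' := (boxIdx_spec y').1
      omega⟩

/-- The placement sends the box point of index `j` to the window site `x_j = j − 1` (`tlmSite j`). [folklore] -/
theorem boxToWindow_apply (n : ℕ) {ℓ : ℕ} (hℓ : ℓ ≤ n + 3) (y : PolySite (halfOpenBox 1 ℓ)) :
    boxToWindow n hℓ y = PolySite.pt (tlmSite (boxIdx y)) (tlmSite_mem (by have := (boxIdx_spec y).2; omega)) := rfl

/-- The placement of the bond partner `x + e₀` is the next window site `x_{j+1}`. [folklore] -/
theorem boxToWindow_succ (n : ℕ) {ℓ : ℕ} (hℓ : ℓ ≤ n + 3) (y : PolySite (halfOpenBox 1 ℓ))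
    (h : ofLex y.1 + unitVec 0 ∈ halfOpenBox 1 ℓ) :
    boxToWindow n hℓ (PolySite.pt (ofLex y.1 + unitVec 0) h) =
      PolySite.pt (tlmSite (boxIdx y + 1)) (tlmSite_mem (by have := (succ_mem_box_iff y).1 h; omega)) := by
  apply polySite_eq_of_coord_eq
  have h1 := (boxIdx_spec (PolySite.pt (ofLex y.1 + unitVec 0) h)).1
  have h2 := (boxIdx_spec y).1
  rw [boxToWindow_apply, PolySite.ofLex_coe_pt, PolySite.ofLex_coe_pt]
  rw [PolySite.ofLex_coe_pt, Pi.add_apply, chain_unitVec_apply_zero] at h1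
  simp only [tlmSite]
  push_cast
  omega

/-! ### Two LTI identities at the reference pair `(-1, 0)` -/

/-- Under the LTI row every site density equals that of the site `-1`; in particular for the site `0`.
[cite: KullEtAl2024, §II.B eq. (locTIn)] -/
theorem trace_nAt_zero_eq_neg_of_lti (n : ℕ) {ρ : Op (PolySite (chainWindow (-1) ((n : ℤ) + 1))) 4}
    (hLTI : spinPartialTrace ((PolySite.affEmb 1 (unitVec 0) (chainWindow (-1) (n : ℤ))).trans
        (PolySite.incl (affShiftSet_chainWindow_subset (-1) (n : ℤ)))) ρ =
      spinPartialTrace (PolySite.incl (chainWindow_mono_right (-1) (by omega : (n : ℤ) ≤ n + 1))) ρ)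
    (hm : -unitVec 0 ∈ chainWindow (-1) ((n : ℤ) + 1)) (hz : (0 : Site 1) ∈ chainWindow (-1) ((n : ℤ) + 1)) (σ : Fin 2) :
    (toSpin (nAt 0 hz σ) * ρ).trace = (toSpin (nAt (-unitVec 0) hm σ) * ρ).trace := by
  have h := trace_nAt_eq_of_lti n (by omega : 1 ≤ n + 2) σ hLTI
  rw [(nAt_tlmSite_zero_one n σ).2] at h
  exact h

/-- Under the LTI row the mean-energy observable `Γ(incl) E_Φ` (objective of `LTIChainNode` / `EntChainNode`, and — via
`Transport.trace_tlmObjective_eq_of_lti` — of `EntTLMChainNode`) has the same expectation as the FIRST BOND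
`U n_{-1↑} n_{-1↓} - Σ_σ (c†_{-1σ} c_{0σ} + h.c.)` (objective of `LTIChainKSDNNode`). [cite: KullEtAl2024, §II.B eq. (locTIn)] -/
theorem trace_meanEnergy_eq_firstBond_of_lti (n : ℕ) (U : ℝ) {ρ : Op (PolySite (chainWindow (-1) ((n : ℤ) + 1))) 4}
    (hLTI : spinPartialTrace ((PolySite.affEmb 1 (unitVec 0) (chainWindow (-1) (n : ℤ))).trans
        (PolySite.incl (affShiftSet_chainWindow_subset (-1) (n : ℤ)))) ρ =
      spinPartialTrace (PolySite.incl (chainWindow_mono_right (-1) (by omega : (n : ℤ) ≤ n + 1))) ρ)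
    (hm : -unitVec 0 ∈ chainWindow (-1) ((n : ℤ) + 1)) (hz : (0 : Site 1) ∈ chainWindow (-1) ((n : ℤ) + 1)) :
    (toSpin (fermionEmbed (PolySite.incl (thicken_zero_one_subset_chainWindow (by omega : (1 : ℤ) ≤ n + 1)))
        ((hubbardFermionInteraction 1 1 U).meanEnergyObs 1)) * ρ).trace =
      (toSpin ((U : ℂ) • (nAt (-unitVec 0) hm 0 * nAt (-unitVec 0) hm 1) +
        (-((1 : ℝ) : ℂ)) • ∑ σ : Fin 2, ((cAt (-unitVec 0) hm σ)ᴴ * cAt 0 hz σ + (cAt 0 hz σ)ᴴ * cAt (-unitVec 0) hm σ)) * ρ).trace := by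
  -- double occupancy of the site `0` = that of the site `-1` (translate the pair block by one site)
  have hD0 : (toSpin (nAt 0 ((tlm_pair_subset n) tlm_zero_mem_pair) 0 * nAt 0 ((tlm_pair_subset n) tlm_zero_mem_pair) 1 :
      FermionOp (chainWindow (-1) ((n : ℤ) + 1))) * ρ).trace =
      (toSpin (nAt (-unitVec 0) ((tlm_pair_subset n) tlm_neg_mem_pair) 0 *
        nAt (-unitVec 0) ((tlm_pair_subset n) tlm_neg_mem_pair) 1 : FermionOp (chainWindow (-1) ((n : ℤ) + 1))) * ρ).trace := by
    have hev : parityAut (nAt (-unitVec 0) tlm_neg_mem_pair 0 * nAt (-unitVec 0) tlm_neg_mem_pair 1 :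
        FermionOp (chainWindow (-1) 0)) = nAt (-unitVec 0) tlm_neg_mem_pair 0 * nAt (-unitVec 0) tlm_neg_mem_pair 1 := by
      rw [map_mul, parityAut_nAt, parityAut_nAt]
    have h1 : 1 ≤ n + 1 := by omega
    have h := trace_toSpin_translate_eq_of_lti n (fun _ => ((1 : ℕ) : ℤ)) (tlm_pair_shift_subset n h1) (tlm_pair_subset n) rfl
      hLTI hev
    rw [fermionEmbed_mul, fermionEmbed_mul, (fermionEmbed_pair_shift_nAt n h1 0).1, (fermionEmbed_pair_shift_nAt n h1 1).1,
      fermionEmbed_incl_nAt, fermionEmbed_incl_nAt, (nAt_tlmSite_zero_one n 0).2, (nAt_tlmSite_zero_one n 1).2] at h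
    exact h
  -- the bond average `h_avg` collapses to the first bond under the LTI row
  have hb : ∀ j : Fin (n + 2),
      (toSpin (tlmBond 1 U (tlmSite (j : ℕ)) (tlmSite ((j : ℕ) + 1)) (tlmSite_mem (by omega)) (tlmSite_mem (by omega))) *
        ρ).trace =
      (toSpin (tlmBond 1 U (-unitVec 0) 0 ((tlm_pair_subset n) tlm_neg_mem_pair) ((tlm_pair_subset n) tlm_zero_mem_pair)) *
        ρ).trace :=
    fun j => trace_tlmBond_eq_of_lti n 1 U (by omega) hLTI
  have hsum : (toSpin (tlmObjective 1 U n) * ρ).trace =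
      (toSpin (tlmBond 1 U (-unitVec 0) 0 ((tlm_pair_subset n) tlm_neg_mem_pair) ((tlm_pair_subset n) tlm_zero_mem_pair)) *
        ρ).trace := by
    rw [tlmObjective, map_smul, map_sum, Matrix.smul_mul, Finset.sum_mul, trace_smul, trace_sum]
    simp_rw [hb]
    rw [Finset.sum_const, Finset.card_univ, Fintype.card_fin, smul_eq_mul, nsmul_eq_mul]
    have hne : ((n : ℂ) + 2) ≠ 0 := by
      have : ((n : ℝ) + 2) ≠ 0 := by positivity
      exact_mod_cast this
    push_cast
    field_simp
  rw [← trace_tlmObjective_eq_of_lti n 1 U hLTI, hsum, tlmBond]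
  simp only [map_add, map_smul, Matrix.add_mul, Matrix.smul_mul, trace_add, trace_smul, smul_eq_mul, hD0, Complex.ofReal_one]
  push_cast
  ring

/-! ### The raw edge: an Anderson certificate bounds the first-bond energy of every LTI window state -/

/-- **Core inequality (rows used: `ρ ⪰ 0`, `tr ρ = 1`, LTI — nothing else).** An Anderson certificate `h(w,v) ⪰ q` on a cluster
`[0, ℓ)`, `ℓ ≤ n + 3`, `Σ w = Σ v = 1`, gives `q + (U/2)(Re tr((n_{-1↑} + n_{-1↓}) ρ) - 1) ≤ Re tr(first bond · ρ)` for every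
window variable. [cite: Anderson1951, eq. (2)] [cite: KullEtAl2024, §II.B eq. (locTIn)] -/
theorem re_firstBond_ge_of_andersonChain (n : ℕ) (U : ℝ) {ℓ : ℕ} (hℓ : ℓ ≤ n + 3) (w v : ℕ → ℝ) (q : ℝ)
    (hw : ∑ j ∈ Finset.range (ℓ - 1), w j = 1) (hv : ∑ j ∈ Finset.range ℓ, v j = 1)
    (hq : (andersonCluster (halfOpenBox 1 ℓ) 1 U (chainBondWeights w) (chainSiteWeights v) -
      (q : ℂ) • (1 : FermionOp (halfOpenBox 1 ℓ))).PosSemidef)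
    {ρ : Op (PolySite (chainWindow (-1) ((n : ℤ) + 1))) 4} (hρ : ρ.PosSemidef) (htr : ρ.trace = 1)
    (hLTI : spinPartialTrace ((PolySite.affEmb 1 (unitVec 0) (chainWindow (-1) (n : ℤ))).trans
        (PolySite.incl (affShiftSet_chainWindow_subset (-1) (n : ℤ)))) ρ =
      spinPartialTrace (PolySite.incl (chainWindow_mono_right (-1) (by omega : (n : ℤ) ≤ n + 1))) ρ)
    (hm : -unitVec 0 ∈ chainWindow (-1) ((n : ℤ) + 1)) (hz : (0 : Site 1) ∈ chainWindow (-1) ((n : ℤ) + 1)) :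
    q + U / 2 * (((toSpin (nAt (-unitVec 0) hm 0 + nAt (-unitVec 0) hm 1) * ρ).trace).re - 1) ≤
      ((toSpin ((U : ℂ) • (nAt (-unitVec 0) hm 0 * nAt (-unitVec 0) hm 1) +
        (-((1 : ℝ) : ℂ)) • ∑ σ : Fin 2, ((cAt (-unitVec 0) hm σ)ᴴ * cAt 0 hz σ + (cAt 0 hz σ)ᴴ * cAt (-unitVec 0) hm σ)) * ρ).trace).re := by
  -- the reference expectations: hopping on the bond `(-1, 0)`, double occupancy and densities of the site `-1`
  set Kc : ℂ := (toSpin (∑ σ : Fin 2, ((cAt (-unitVec 0) hm σ)ᴴ * cAt 0 hz σ + (cAt 0 hz σ)ᴴ * cAt (-unitVec 0) hm σ)) * ρ).trace with hKc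
  set Dc : ℂ := (toSpin (nAt (-unitVec 0) hm 0 * nAt (-unitVec 0) hm 1) * ρ).trace with hDc
  have hN : ∀ (c : ℕ) (hc : c ≤ n + 2) (σ : Fin 2), (toSpin (nAt (tlmSite c) (tlmSite_mem hc) σ) * ρ).trace =
      (toSpin (nAt (-unitVec 0) hm σ) * ρ).trace :=
    fun c hc σ => trace_nAt_eq_of_lti n hc σ hLTI
  -- (1) every bond hopping has the expectation `Kc` (the `tlmBond` lemma at `U = 0`)
  have hK : ∀ (c : ℕ) (hc : c ≤ n + 1), (toSpin (∑ σ : Fin 2,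
      ((cAt (tlmSite c) (tlmSite_mem (by omega)) σ)ᴴ * cAt (tlmSite (c + 1)) (tlmSite_mem (by omega)) σ +
        (cAt (tlmSite (c + 1)) (tlmSite_mem (by omega)) σ)ᴴ * cAt (tlmSite c) (tlmSite_mem (by omega)) σ) :
      FermionOp (chainWindow (-1) ((n : ℤ) + 1))) * ρ).trace = Kc := by
    intro c hc
    have h := trace_tlmBond_eq_of_lti n 1 0 hc hLTI
    simp only [tlmBond, zero_div, Complex.ofReal_zero, Complex.ofReal_one, zero_smul, add_zero, neg_smul, one_smul,
      map_neg, Matrix.neg_mul, trace_neg, neg_inj] at h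
    rw [hKc]
    exact h
  -- (2) every double occupancy has the expectation `Dc`
  have hDA : ∀ (c : ℕ) (hc : c ≤ n + 1), (toSpin (nAt (tlmSite c) (tlmSite_mem (by omega)) 0 *
      nAt (tlmSite c) (tlmSite_mem (by omega)) 1) * ρ).trace = Dc := by
    intro c hc
    have hev : parityAut (nAt (-unitVec 0) tlm_neg_mem_pair 0 * nAt (-unitVec 0) tlm_neg_mem_pair 1 :
        FermionOp (chainWindow (-1) 0)) = nAt (-unitVec 0) tlm_neg_mem_pair 0 * nAt (-unitVec 0) tlm_neg_mem_pair 1 := by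
      rw [map_mul, parityAut_nAt, parityAut_nAt]
    have h := trace_toSpin_translate_eq_of_lti n (fun _ => (c : ℤ)) (tlm_pair_shift_subset n hc) (tlm_pair_subset n) rfl
      hLTI hev
    rw [fermionEmbed_mul, fermionEmbed_mul, (fermionEmbed_pair_shift_nAt n hc 0).1, (fermionEmbed_pair_shift_nAt n hc 1).1,
      fermionEmbed_incl_nAt, fermionEmbed_incl_nAt] at h
    rw [hDc]
    exact h
  have hD : ∀ (c : ℕ) (hc : c ≤ n + 2), (toSpin (nAt (tlmSite c) (tlmSite_mem hc) 0 *
      nAt (tlmSite c) (tlmSite_mem hc) 1) * ρ).trace = Dc := by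
    intro c hc
    rcases Nat.lt_or_ge c (n + 2) with h | h
    · exact hDA c (by omega)
    · obtain rfl : c = n + 2 := le_antisymm hc h
      have hev : parityAut (nAt 0 tlm_zero_mem_pair 0 * nAt 0 tlm_zero_mem_pair 1 : FermionOp (chainWindow (-1) 0)) =
          nAt 0 tlm_zero_mem_pair 0 * nAt 0 tlm_zero_mem_pair 1 := by
        rw [map_mul, parityAut_nAt, parityAut_nAt]
      have h2 := trace_toSpin_translate_eq_of_lti n (fun _ => ((n + 1 : ℕ) : ℤ)) (tlm_pair_shift_subset n le_rfl)
        (tlm_pair_subset n) rfl hLTI hev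
      rw [fermionEmbed_mul, fermionEmbed_mul, (fermionEmbed_pair_shift_nAt n le_rfl 0).2,
        (fermionEmbed_pair_shift_nAt n le_rfl 1).2, fermionEmbed_incl_nAt, fermionEmbed_incl_nAt,
        ← (nAt_tlmSite_zero_one n 0).2, ← (nAt_tlmSite_zero_one n 1).2, hDA 1 (by omega)] at h2
      exact h2
  -- (4) the embedded cluster Hamiltonian: `⟨Γ(placement) h(w,v)⟩ = -Kc + (U/2)(2 Dc - N + 1)`
  have hidx : ∀ y : PolySite (halfOpenBox 1 ℓ), boxIdx y ≤ n + 2 := fun y => by have := (boxIdx_spec y).2; omega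
  have hNy : ∀ (y : PolySite (halfOpenBox 1 ℓ)) (σ : Fin 2),
      (toSpin (numberOp (boxToWindow n hℓ y) σ) * ρ).trace = (toSpin (nAt (-unitVec 0) hm σ) * ρ).trace :=
    fun y σ => hN (boxIdx y) (hidx y) σ
  have hDy : ∀ y : PolySite (halfOpenBox 1 ℓ),
      (toSpin (numberOp (boxToWindow n hℓ y) 0 * numberOp (boxToWindow n hℓ y) 1) * ρ).trace = Dc :=
    fun y => hD (boxIdx y) (hidx y)
  have hBy : ∀ y : PolySite (halfOpenBox 1 ℓ),
      (toSpin (fermionEmbed (boxToWindow n hℓ) (clusterBondKinetic (halfOpenBox 1 ℓ) y 0)) * ρ).trace =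
        if ofLex y.1 + unitVec 0 ∈ halfOpenBox 1 ℓ then Kc else 0 := by
    intro y
    unfold clusterBondKinetic
    by_cases h : ofLex y.1 + unitVec 0 ∈ halfOpenBox 1 ℓ
    · have hj : boxIdx y + 1 < ℓ := (succ_mem_box_iff y).1 h
      rw [dif_pos h, if_pos h, fermionEmbed_sum]
      simp only [fermionEmbed_add, fermionEmbed_mul, fermionEmbed_creation, fermionEmbed_annihilation]
      rw [boxToWindow_succ n hℓ y h, boxToWindow_apply]
      have hk := hK (boxIdx y) (by omega)
      simp only [cAt, annihilation_conjTranspose] at hk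
      exact hk
    · rw [dif_neg h, if_neg h, fermionEmbed_zero, map_zero, Matrix.zero_mul, trace_zero]
  have hbw : ∀ y : PolySite (halfOpenBox 1 ℓ),
      ((chainBondWeights w (ofLex y.1) 0 : ℝ) : ℂ) *
          (toSpin (fermionEmbed (boxToWindow n hℓ) (clusterBondKinetic (halfOpenBox 1 ℓ) y 0)) * ρ).trace =
        ((AndersonCluster.bondWeight (halfOpenBox 1 ℓ) (chainBondWeights w) (ofLex y.1) 0 : ℝ) : ℂ) * Kc := by
    intro y
    rw [hBy y]
    unfold AndersonCluster.bondWeight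
    by_cases h : ofLex y.1 + unitVec 0 ∈ halfOpenBox 1 ℓ
    · rw [if_pos h, if_pos h]
    · rw [if_neg h, if_neg h, mul_zero, Complex.ofReal_zero, zero_mul]
  have hexp : (toSpin (fermionEmbed (boxToWindow n hℓ)
      (andersonCluster (halfOpenBox 1 ℓ) 1 U (chainBondWeights w) (chainSiteWeights v))) * ρ).trace =
        -Kc + ((U / 2 : ℝ) : ℂ) * (2 * Dc - ((toSpin (nAt (-unitVec 0) hm 0) * ρ).trace +
          (toSpin (nAt (-unitVec 0) hm 1) * ρ).trace) + 1) := by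
    simp only [andersonCluster, fermionEmbed_add, fermionEmbed_sub, fermionEmbed_smul, fermionEmbed_sum, fermionEmbed_mul,
      fermionEmbed_one, fermionEmbed_numberOp, Fin.sum_univ_one]
    simp only [map_add, map_sub, map_smul, map_sum, map_one, Matrix.add_mul, Matrix.sub_mul, Matrix.smul_mul,
      Matrix.one_mul, Finset.sum_mul, trace_add, trace_sub, trace_smul, trace_sum, smul_eq_mul, htr, hNy, hDy, hbw,
      Complex.ofReal_one]
    rw [← Finset.sum_mul, ← Finset.sum_mul]
    have hS1 : ∑ y : PolySite (halfOpenBox 1 ℓ),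
        ((AndersonCluster.bondWeight (halfOpenBox 1 ℓ) (chainBondWeights w) (ofLex y.1) 0 : ℝ) : ℂ) = 1 := by
      rw [← Complex.ofReal_one, ← hw, ← bondWeightSum_halfOpenBox_one_chainBondWeights, bondWeightSum, ← sum_ofLex_eq', Complex.ofReal_sum]
    have hS2 : ∑ y : PolySite (halfOpenBox 1 ℓ), ((chainSiteWeights v (ofLex y.1) : ℝ) : ℂ) = 1 := by
      rw [← Complex.ofReal_one, ← hv, ← siteWeightSum_halfOpenBox_one, siteWeightSum, ← sum_ofLex_eq', Complex.ofReal_sum]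
    rw [hS1, hS2]
    push_cast
    ring
  -- (5) positivity pairing: `toSpin Γ(h) - q ⪰ 0`, `ρ ⪰ 0` ⇒ `q ≤ Re ⟨Γ h⟩`
  have hpsd : (toSpin (fermionEmbed (boxToWindow n hℓ)
      (andersonCluster (halfOpenBox 1 ℓ) 1 U (chainBondWeights w) (chainSiteWeights v))) -
        (q : ℂ) • (1 : Op (PolySite (chainWindow (-1) ((n : ℤ) + 1))) 4)).PosSemidef := by
    have h1 := posSemidef_fermionEmbed_sub_smul_one (boxToWindow n hℓ) hq
    have h2 := (posSemidef_toSpin_iff _).2 h1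
    rwa [map_sub, map_smul, map_one] at h2
  have hineq : q ≤ ((toSpin (fermionEmbed (boxToWindow n hℓ)
      (andersonCluster (halfOpenBox 1 ℓ) 1 U (chainBondWeights w) (chainSiteWeights v))) * ρ).trace).re := by
    obtain ⟨B, hB⟩ := CStarAlgebra.nonneg_iff_eq_star_mul_self.mp hpsd.nonneg
    have h0 : 0 ≤ (((toSpin (fermionEmbed (boxToWindow n hℓ)
        (andersonCluster (halfOpenBox 1 ℓ) 1 U (chainBondWeights w) (chainSiteWeights v))) -
          (q : ℂ) • (1 : Op (PolySite (chainWindow (-1) ((n : ℤ) + 1))) 4)) * ρ).trace).re := by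
      rw [hB, star_eq_conjTranspose, Matrix.mul_assoc, trace_mul_comm]
      exact (Complex.nonneg_iff.mp (hρ.mul_mul_conjTranspose_same B).trace_nonneg).1
    rw [Matrix.sub_mul, Matrix.smul_mul, Matrix.one_mul, trace_sub, trace_smul, smul_eq_mul, Complex.sub_re, htr, mul_one,
      Complex.ofReal_re] at h0
    linarith
  -- (6) assemble: expand the first bond and the density row of the statement into `Kc`, `Dc`, `N_{-1σ}`
  rw [hexp] at hineq
  have e2 : (2 : ℂ) = ((2 : ℝ) : ℂ) := by norm_num
  rw [e2] at hineq
  simp only [map_add, map_smul, Matrix.add_mul, Matrix.smul_mul, trace_add, trace_smul, smul_eq_mul, ← hKc, ← hDc]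
  simp only [Complex.add_re, Complex.neg_re, Complex.sub_re, Complex.re_ofReal_mul, Complex.one_re, Complex.ofReal_one,
    neg_mul, one_mul] at hineq ⊢
  linarith

end Summit.Ventures.CertifiedManyBodySolver.Rows.AndersonDominatedByLTI

end
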